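import Summits.QuantumFields.YangMills.Theorems.UnitScaleTiltProp7TPrintDefs
import Summits.QuantumFields.YangMills.Theorems.UnitScaleTiltProp7SPrintIn19Dict
import HarnessLib

/-!
# Route `UnitScaleTilt`, crux K1 child «MinimiserStabilityRegPr» (stmt-QuantumFields-19200), skeleton v10, stub `stub_existenceMinimalOrbit` (EX),
# route (α) — **THE ALGEBRA OF THE (19)-SIZE `nMax19`**: the four second-order-calculus families of [Balaban1985Variational] (19) are ADDITIVE and
# `ℂ`-HOMOGENEOUS in the one-form at a fixed background, hence print's size `nMax19 U₀ X` (✓`Prop7TPrint.nMax19`, the largest of `‖X(b)‖/η`,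
# `‖(∇¹_{U₀}X)_{μν}(x)‖/η²`, `‖(D¹*_{U₀}D¹_{U₀}X)_μ(x)‖/η³`, `‖(Δ¹_{U₀}X)_ν(x)‖/η³`) is a SEMINORM: `nMax19 (X + Y) ≤ nMax19 X + nMax19 Y`,
# `nMax19 (c • X) ≤ ‖c‖·nMax19 X`, `nMax19 (−X) = nMax19 X`, `nMax19 0 = 0`, with the member-wise INTRO∕ELIM rule `nMax19_le_iff`.

Cell `ym3-torus`, width seat `ym3-torus-px14` (gen 0; WIDTH COPY of `ym3-torus-p1`).  THEOREMS ONLY (0 `def`, 0 `sorry`).  `--supports stmt-QuantumFields-19200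
--as helper`, count-neutral.  YM₃ on T³ is a ladder rung (R3), not the Clay problem; nothing here claims the stub, the crux, d = 4 or the mass gap.

WHY.  The EX knit of record v3.3ˢ (✓`Prop7StubEXOfChartPiecesTwS6.stubEX_of_chartPiecesTwS6`) displays the (19)-size row `hSize19` WHOLE (★★OWNER RULING
g27-№7 (1), re-lettered `hSize19′ : prefix → nMax19 U₀ X ≤ M L · α L`).  Print obtains that size TERM BY TERM ([Balaban1985Variational] p. 299: «`A′₁ − HD(A′₁) =
(1∕iη) log U₁` satisfying all the conditions (19)–(21) with `ε₂ = O(1)C₁B₃ε₁`», `A′₁ = A₁ + H₁B` p. 296; orders 0∕1 from (115)–(116), (45)–(46); order 2 from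
(136), (137)–(140)) — so whoever supplies `hSize19′` sums per-term rows (`h46∇`, `hΔsol`, `hΔH`, the in-cell (Z)∕(F) rows of `LOCATE-HSIZE19-CUT-w2g5.md` §2)
into ONE bound on `nMax19 U₀ (η•ι(A₁ + H₁B) + X₂)`.  That needs: additivity of `covGradT ∕ covCodiffCurlT ∕ covLapFormT` in the one-form (the tree had
`_smul` (real), `_eq_smul`, `_one`, `_pull` — ✓`Prop7SPrintIn19` §2, ✓`T3SectALandauChart` §2.1 — no `_add`), the triangle inequality for the four `Finset.sup'`
families, and the `≤ ε` member rule (the tree had the strict `nMax19_lt_iff` only).  This file supplies exactly these; it proves NO size row of print.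

WHAT IS PROVED (sorry-free, no definition).
§1 (any torus `T^{(s)}`, normed `ℂ`-algebra `𝔸`, background `V`, spacing `η`): `_add ∕ _neg ∕ _sub ∕ _smul_complex` for `covDerivFwdT`, `covDerivT`, `covGradT`,
   `covCurlT`, `covCodiffT`, `covCodiffCurlT`, `covLapFormT` (+ `_zero` at second order) — [Balaban1985RegularSpaces] (1.1)–(1.2): `R(U)` is linear.
§2 (member `F`, heights `n K`, background `U₀`): `nMax19_le_iff`, `nMax19_nonneg`, the four ELIM rules `norm_le_nMax19_mul_eta`, `norm_covGradT_le_nMax19`,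
   `norm_covCodiffCurlT_le_nMax19`, `norm_covLapFormT_le_nMax19`, ★`nMax19_add_le`, `nMax19_neg`, `nMax19_sub_le`, `nMax19_zero`,
   ★`nMax19_smul_le` (`c : ℂ`), `nMax19_smul_of_norm_eq_one` (`‖c‖ = 1`, e.g. the knit's `X := −i·χ(A′)`), `nMax19_sum_le`.
§3 the split reader for (i) `X = c•(a•(X₁ + X₂) − X₃)`, `‖c‖ = 1` (v3.3ˢ `hSize19`'s exponent, `c = −i`, `a = η·i`): `nMax19_lambda_smul_of_norm_eq_one`,
   ★`nMax19_split_le`, ★`nMax19_split_le_of_le` — ONE step from member rows to `hSize19′`'s left side.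

HONEST SCOPE.  Pure bookkeeping (linearity + `Finset.sup'` order lemmas); no estimate of Bałaban's is proved or assumed; nothing of EX∕H∕the crux is claimed.

References: T. Bałaban, CMP 102 (1985) 277–309 [Balaban1985Variational] ((19) p.281, (45)–(46) p.285, (112) p.294, (115)–(116) pp.294–295, (136)–(140) pp.298–299);
CMP 99 (1985) 75–102 [Balaban1985RegularSpaces] ((1.1)–(1.2) p.76, (1.39) p.83, (1.47) p.84); CMP 98 (1985) 17–51 [Balaban1985Averaging] ((56) p.27).
-/

set_option autoImplicit false

noncomputable section

open scoped BigOperators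

namespace Summit.QuantumFields.YangMills.Theorems.Prop7NMax19Algebra

open Literature.MathematicalPhysics.QuantumFieldTheory.Balaban1983to89
open Literature.MathematicalPhysics.QuantumFieldTheory.Balaban1983to89.T3ContinuumYM3Torus
open T3SectALandauChart
open B7Eq78Linearization (conjR conjR_apply conjR_add conjR_sub conjR_smul)
open B8Eq146AExpansion (conjR_neg)
open B10Eq68TorusRegularity (covDerivT)
open Summit.QuantumFields.YangMills.Theorems.Prop7TPrint (nMax19 univ_pbond_nonempty univ_grad_nonempty univ_form_nonempty)

/-! ## §1 The covariant one-form calculus (1.1)–(1.2) is additive and `ℂ`-homogeneous in the field -/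

section Calculus

variable {P : Params} {s : ℕ} {𝔸 : Type*} [NormedRing 𝔸] [NormedAlgebra ℂ 𝔸]

/-- `D^η_{V,μ}(G + H) = D^η_{V,μ}G + D^η_{V,μ}H`. [cite: Balaban1985RegularSpaces, (1.1) p.76] -/
theorem covDerivFwdT_add (η : ℝ) (V : GaugeField P s 𝔸ˣ) (μ : Fin P.d) (G H : Site P s → 𝔸) (x : Site P s) :
    covDerivFwdT η V μ (G + H) x = covDerivFwdT η V μ G x + covDerivFwdT η V μ H x := by
  simp only [covDerivFwdT, Pi.add_apply, conjR_add, ← smul_add]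
  congr 1
  abel

/-- `D^η_{V,μ}(−G) = −D^η_{V,μ}G`. [cite: Balaban1985RegularSpaces, (1.1) p.76] -/
theorem covDerivFwdT_neg (η : ℝ) (V : GaugeField P s 𝔸ˣ) (μ : Fin P.d) (G : Site P s → 𝔸) (x : Site P s) :
    covDerivFwdT η V μ (-G) x = -covDerivFwdT η V μ G x := by
  simp only [covDerivFwdT, Pi.neg_apply, conjR_neg, ← smul_neg]
  congr 1
  abel

/-- `D^η_{V,μ}(G − H) = D^η_{V,μ}G − D^η_{V,μ}H`. [cite: Balaban1985RegularSpaces, (1.1) p.76] -/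
theorem covDerivFwdT_sub (η : ℝ) (V : GaugeField P s 𝔸ˣ) (μ : Fin P.d) (G H : Site P s → 𝔸) (x : Site P s) :
    covDerivFwdT η V μ (G - H) x = covDerivFwdT η V μ G x - covDerivFwdT η V μ H x := by
  rw [sub_eq_add_neg, covDerivFwdT_add, covDerivFwdT_neg, ← sub_eq_add_neg]

/-- `D^η_{V,μ}(cG) = c·D^η_{V,μ}G` (complex `c`). [cite: Balaban1985RegularSpaces, (1.1) p.76] -/
theorem covDerivFwdT_smul_complex (η : ℝ) (c : ℂ) (V : GaugeField P s 𝔸ˣ) (μ : Fin P.d) (G : Site P s → 𝔸) (x : Site P s) :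
    covDerivFwdT η V μ (c • G) x = c • covDerivFwdT η V μ G x := by
  simp only [covDerivFwdT, Pi.smul_apply, conjR_smul, ← smul_sub]
  rw [smul_comm]

/-- `D^{η*}_{V,ν}(G + H) = D^{η*}_{V,ν}G + D^{η*}_{V,ν}H`. [cite: Balaban1985RegularSpaces, (1.1) p.76] -/
theorem covDerivT_add (η : ℝ) (V : GaugeField P s 𝔸ˣ) (ν : Fin P.d) (G H : Site P s → 𝔸) (x : Site P s) :
    covDerivT η V ν (G + H) x = covDerivT η V ν G x + covDerivT η V ν H x := by
  simp only [covDerivT, Pi.add_apply, conjR_add, ← smul_add]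
  congr 1
  abel

/-- `D^{η*}_{V,ν}(−G) = −D^{η*}_{V,ν}G`. [cite: Balaban1985RegularSpaces, (1.1) p.76] -/
theorem covDerivT_neg (η : ℝ) (V : GaugeField P s 𝔸ˣ) (ν : Fin P.d) (G : Site P s → 𝔸) (x : Site P s) :
    covDerivT η V ν (-G) x = -covDerivT η V ν G x := by
  simp only [covDerivT, Pi.neg_apply, conjR_neg, ← smul_neg]
  congr 1
  abel

/-- `D^{η*}_{V,ν}(G − H) = D^{η*}_{V,ν}G − D^{η*}_{V,ν}H`. [cite: Balaban1985RegularSpaces, (1.1) p.76] -/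
theorem covDerivT_sub (η : ℝ) (V : GaugeField P s 𝔸ˣ) (ν : Fin P.d) (G H : Site P s → 𝔸) (x : Site P s) :
    covDerivT η V ν (G - H) x = covDerivT η V ν G x - covDerivT η V ν H x := by
  rw [sub_eq_add_neg, covDerivT_add, covDerivT_neg, ← sub_eq_add_neg]

/-- `D^{η*}_{V,ν}(cG) = c·D^{η*}_{V,ν}G` (complex `c`). [cite: Balaban1985RegularSpaces, (1.1) p.76] -/
theorem covDerivT_smul_complex (η : ℝ) (c : ℂ) (V : GaugeField P s 𝔸ˣ) (ν : Fin P.d) (G : Site P s → 𝔸) (x : Site P s) :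
    covDerivT η V ν (c • G) x = c • covDerivT η V ν G x := by
  simp only [covDerivT, Pi.smul_apply, conjR_smul, ← smul_sub]
  rw [smul_comm]

omit [NormedRing 𝔸] [NormedAlgebra ℂ 𝔸] in
/-- `(X + Y)_ν = X_ν + Y_ν`. [cite: Balaban1984PropagatorsI, (1.1) p.18] -/
theorem formComp_add [Add 𝔸] (X Y : PBond P s → 𝔸) (ν : Fin P.d) : formComp (X + Y) ν = formComp X ν + formComp Y ν := rfl

omit [NormedRing 𝔸] [NormedAlgebra ℂ 𝔸] in
/-- `(−X)_ν = −X_ν`. [cite: Balaban1984PropagatorsI, (1.1) p.18] -/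
theorem formComp_neg [Neg 𝔸] (X : PBond P s → 𝔸) (ν : Fin P.d) : formComp (-X) ν = -formComp X ν := rfl

omit [NormedRing 𝔸] [NormedAlgebra ℂ 𝔸] in
/-- `(c•X)_ν = c•X_ν`. [cite: Balaban1984PropagatorsI, (1.1) p.18] -/
theorem formComp_smul {R : Type*} [SMul R 𝔸] (c : R) (X : PBond P s → 𝔸) (ν : Fin P.d) : formComp (c • X) ν = c • formComp X ν := rfl

/-- `∇^η_V(X + Y) = ∇^η_V X + ∇^η_V Y`. [cite: Balaban1985Variational, (19) p.281] -/
theorem covGradT_add (η : ℝ) (V : GaugeField P s 𝔸ˣ) (X Y : PBond P s → 𝔸) (μ ν : Fin P.d) (x : Site P s) :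
    covGradT η V (X + Y) μ ν x = covGradT η V X μ ν x + covGradT η V Y μ ν x := by
  simp only [covGradT, formComp_add, covDerivFwdT_add]

/-- `∇^η_V(−X) = −∇^η_V X`. [cite: Balaban1985Variational, (19) p.281] -/
theorem covGradT_neg (η : ℝ) (V : GaugeField P s 𝔸ˣ) (X : PBond P s → 𝔸) (μ ν : Fin P.d) (x : Site P s) :
    covGradT η V (-X) μ ν x = -covGradT η V X μ ν x := by
  simp only [covGradT, formComp_neg, covDerivFwdT_neg]

/-- `∇^η_V(X − Y) = ∇^η_V X − ∇^η_V Y`. [cite: Balaban1985Variational, (19) p.281] -/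
theorem covGradT_sub (η : ℝ) (V : GaugeField P s 𝔸ˣ) (X Y : PBond P s → 𝔸) (μ ν : Fin P.d) (x : Site P s) :
    covGradT η V (X - Y) μ ν x = covGradT η V X μ ν x - covGradT η V Y μ ν x := by
  rw [sub_eq_add_neg, covGradT_add, covGradT_neg, ← sub_eq_add_neg]

/-- `∇^η_V(cX) = c·∇^η_V X` (complex `c`). [cite: Balaban1985Variational, (19) p.281] -/
theorem covGradT_smul_complex (η : ℝ) (c : ℂ) (V : GaugeField P s 𝔸ˣ) (X : PBond P s → 𝔸) (μ ν : Fin P.d) (x : Site P s) :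
    covGradT η V (c • X) μ ν x = c • covGradT η V X μ ν x := by
  simp only [covGradT, formComp_smul, covDerivFwdT_smul_complex]

/-- `D^η_V(X + Y) = D^η_V X + D^η_V Y` on plaquettes. [cite: Balaban1985RegularSpaces, (1.47) p.84] -/
theorem covCurlT_add (η : ℝ) (V : GaugeField P s 𝔸ˣ) (X Y : PBond P s → 𝔸) (μ ν : Fin P.d) (x : Site P s) :
    covCurlT η V (X + Y) μ ν x = covCurlT η V X μ ν x + covCurlT η V Y μ ν x := by
  simp only [covCurlT, covGradT_add]
  abel

/-- `D^η_V(−X) = −D^η_V X` on plaquettes. [cite: Balaban1985RegularSpaces, (1.47) p.84] -/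
theorem covCurlT_neg (η : ℝ) (V : GaugeField P s 𝔸ˣ) (X : PBond P s → 𝔸) (μ ν : Fin P.d) (x : Site P s) :
    covCurlT η V (-X) μ ν x = -covCurlT η V X μ ν x := by
  simp only [covCurlT, covGradT_neg]
  abel

/-- `D^η_V(cX) = c·D^η_V X` on plaquettes (complex `c`). [cite: Balaban1985RegularSpaces, (1.47) p.84] -/
theorem covCurlT_smul_complex (η : ℝ) (c : ℂ) (V : GaugeField P s 𝔸ˣ) (X : PBond P s → 𝔸) (μ ν : Fin P.d) (x : Site P s) :
    covCurlT η V (c • X) μ ν x = c • covCurlT η V X μ ν x := by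
  simp only [covCurlT, covGradT_smul_complex, smul_sub]

/-- (1.2) is additive in the plaquette function. [cite: Balaban1985RegularSpaces, (1.2) p.76] -/
theorem covCodiffT_add (η : ℝ) (V : GaugeField P s 𝔸ˣ) (Fp Gp : Fin P.d → Fin P.d → Site P s → 𝔸) (μ : Fin P.d) (x : Site P s) :
    covCodiffT η V (Fp + Gp) μ x = covCodiffT η V Fp μ x + covCodiffT η V Gp μ x := by
  simp only [covCodiffT, Pi.add_apply, covDerivT_add, Finset.sum_add_distrib]
  abel

/-- (1.2) is odd in the plaquette function. [cite: Balaban1985RegularSpaces, (1.2) p.76] -/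
theorem covCodiffT_neg (η : ℝ) (V : GaugeField P s 𝔸ˣ) (Fp : Fin P.d → Fin P.d → Site P s → 𝔸) (μ : Fin P.d) (x : Site P s) :
    covCodiffT η V (-Fp) μ x = -covCodiffT η V Fp μ x := by
  simp only [covCodiffT, Pi.neg_apply, covDerivT_neg, Finset.sum_neg_distrib]
  abel

/-- (1.2) is `ℂ`-homogeneous in the plaquette function. [cite: Balaban1985RegularSpaces, (1.2) p.76] -/
theorem covCodiffT_smul_complex (η : ℝ) (c : ℂ) (V : GaugeField P s 𝔸ˣ) (Fp : Fin P.d → Fin P.d → Site P s → 𝔸) (μ : Fin P.d) (x : Site P s) :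
    covCodiffT η V (c • Fp) μ x = c • covCodiffT η V Fp μ x := by
  simp only [covCodiffT, Pi.smul_apply, covDerivT_smul_complex, ← Finset.smul_sum, smul_sub]

/-- `D^{η*}_V D^η_V (X + Y) = D^{η*}_V D^η_V X + D^{η*}_V D^η_V Y`. [cite: Balaban1985RegularSpaces, (1.39) p.83] -/
theorem covCodiffCurlT_add (η : ℝ) (V : GaugeField P s 𝔸ˣ) (X Y : PBond P s → 𝔸) (μ : Fin P.d) (x : Site P s) :
    covCodiffCurlT η V (X + Y) μ x = covCodiffCurlT η V X μ x + covCodiffCurlT η V Y μ x := by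
  have h : covCurlT η V (X + Y) = covCurlT η V X + covCurlT η V Y := by
    funext μ' ν' x'; exact covCurlT_add η V X Y μ' ν' x'
  simp only [covCodiffCurlT, h, covCodiffT_add]

/-- `D^{η*}_V D^η_V (−X) = −D^{η*}_V D^η_V X`. [cite: Balaban1985RegularSpaces, (1.39) p.83] -/
theorem covCodiffCurlT_neg (η : ℝ) (V : GaugeField P s 𝔸ˣ) (X : PBond P s → 𝔸) (μ : Fin P.d) (x : Site P s) :
    covCodiffCurlT η V (-X) μ x = -covCodiffCurlT η V X μ x := by
  have h : covCurlT η V (-X) = -covCurlT η V X := by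
    funext μ' ν' x'; exact covCurlT_neg η V X μ' ν' x'
  simp only [covCodiffCurlT, h, covCodiffT_neg]

/-- `D^{η*}_V D^η_V (X − Y) = D^{η*}_V D^η_V X − D^{η*}_V D^η_V Y`. [cite: Balaban1985RegularSpaces, (1.39) p.83] -/
theorem covCodiffCurlT_sub (η : ℝ) (V : GaugeField P s 𝔸ˣ) (X Y : PBond P s → 𝔸) (μ : Fin P.d) (x : Site P s) :
    covCodiffCurlT η V (X - Y) μ x = covCodiffCurlT η V X μ x - covCodiffCurlT η V Y μ x := by
  rw [sub_eq_add_neg, covCodiffCurlT_add, covCodiffCurlT_neg, ← sub_eq_add_neg]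

/-- `D^{η*}_V D^η_V (cX) = c·D^{η*}_V D^η_V X` (complex `c`). [cite: Balaban1985RegularSpaces, (1.39) p.83] -/
theorem covCodiffCurlT_smul_complex (η : ℝ) (c : ℂ) (V : GaugeField P s 𝔸ˣ) (X : PBond P s → 𝔸) (μ : Fin P.d) (x : Site P s) :
    covCodiffCurlT η V (c • X) μ x = c • covCodiffCurlT η V X μ x := by
  have h : covCurlT η V (c • X) = c • covCurlT η V X := by
    funext μ' ν' x'; exact covCurlT_smul_complex η c V X μ' ν' x'
  simp only [covCodiffCurlT, h, covCodiffT_smul_complex]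

/-- `D^{η*}_V D^η_V 0 = 0`. [cite: Balaban1985RegularSpaces, (1.39) p.83] -/
theorem covCodiffCurlT_zero (η : ℝ) (V : GaugeField P s 𝔸ˣ) (μ : Fin P.d) (x : Site P s) :
    covCodiffCurlT η V (0 : PBond P s → 𝔸) μ x = 0 := by
  have h := covCodiffCurlT_smul_complex η (0 : ℂ) V (0 : PBond P s → 𝔸) μ x
  rwa [zero_smul, zero_smul] at h

/-- `Δ^η_V (X + Y) = Δ^η_V X + Δ^η_V Y`. [cite: Balaban1985RegularSpaces, (1.39) p.83] -/
theorem covLapFormT_add (η : ℝ) (V : GaugeField P s 𝔸ˣ) (X Y : PBond P s → 𝔸) (ν : Fin P.d) (x : Site P s) :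
    covLapFormT η V (X + Y) ν x = covLapFormT η V X ν x + covLapFormT η V Y ν x := by
  have h : ∀ μ : Fin P.d, covDerivFwdT η V μ (formComp (X + Y) ν) = covDerivFwdT η V μ (formComp X ν) + covDerivFwdT η V μ (formComp Y ν) :=
    fun μ => funext fun x' => by rw [formComp_add, covDerivFwdT_add]; rfl
  simp only [covLapFormT, h, covDerivT_add, Finset.sum_add_distrib]

/-- `Δ^η_V (−X) = −Δ^η_V X`. [cite: Balaban1985RegularSpaces, (1.39) p.83] -/
theorem covLapFormT_neg (η : ℝ) (V : GaugeField P s 𝔸ˣ) (X : PBond P s → 𝔸) (ν : Fin P.d) (x : Site P s) :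
    covLapFormT η V (-X) ν x = -covLapFormT η V X ν x := by
  have h : ∀ μ : Fin P.d, covDerivFwdT η V μ (formComp (-X) ν) = -covDerivFwdT η V μ (formComp X ν) :=
    fun μ => funext fun x' => by rw [formComp_neg, covDerivFwdT_neg]; rfl
  simp only [covLapFormT, h, covDerivT_neg, Finset.sum_neg_distrib]

/-- `Δ^η_V (X − Y) = Δ^η_V X − Δ^η_V Y`. [cite: Balaban1985RegularSpaces, (1.39) p.83] -/
theorem covLapFormT_sub (η : ℝ) (V : GaugeField P s 𝔸ˣ) (X Y : PBond P s → 𝔸) (ν : Fin P.d) (x : Site P s) :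
    covLapFormT η V (X - Y) ν x = covLapFormT η V X ν x - covLapFormT η V Y ν x := by
  rw [sub_eq_add_neg, covLapFormT_add, covLapFormT_neg, ← sub_eq_add_neg]

/-- `Δ^η_V (cX) = c·Δ^η_V X` (complex `c`). [cite: Balaban1985RegularSpaces, (1.39) p.83] -/
theorem covLapFormT_smul_complex (η : ℝ) (c : ℂ) (V : GaugeField P s 𝔸ˣ) (X : PBond P s → 𝔸) (ν : Fin P.d) (x : Site P s) :
    covLapFormT η V (c • X) ν x = c • covLapFormT η V X ν x := by
  have h : ∀ μ : Fin P.d, covDerivFwdT η V μ (formComp (c • X) ν) = c • covDerivFwdT η V μ (formComp X ν) :=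
    fun μ => funext fun x' => by rw [formComp_smul, covDerivFwdT_smul_complex]; rfl
  simp only [covLapFormT, h, covDerivT_smul_complex, ← Finset.smul_sum]

/-- `Δ^η_V 0 = 0`. [cite: Balaban1985RegularSpaces, (1.39) p.83] -/
theorem covLapFormT_zero (η : ℝ) (V : GaugeField P s 𝔸ˣ) (ν : Fin P.d) (x : Site P s) :
    covLapFormT η V (0 : PBond P s → 𝔸) ν x = 0 := by
  have h := covLapFormT_smul_complex η (0 : ℂ) V (0 : PBond P s → 𝔸) ν x
  rwa [zero_smul, zero_smul] at h

end Calculus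

/-! ## §2 `nMax19` is a seminorm; member-wise intro and elim -/

section Size

open scoped Matrix.Norms.L2Operator

variable {F : T3Family} {n K : ℕ}

/-- **`nMax19 U₀ X ≤ ε` IFF `X` SATISFIES THE FOUR BOUNDS OF (19) WITH `ε` NON-STRICTLY** (the `≤` twin of ✓`Prop7TPrint.nMax19_lt_iff`; the
member-wise INTRO rule for a bound `nMax19 U₀ X ≤ M·α`). [cite: Balaban1985Variational, (19) p.281] -/
theorem nMax19_le_iff {ε : ℝ} {U₀ : GaugeField (F.P K) 0 (Matrix.specialUnitaryGroup (Fin 2) ℂ)} {X : PBond (F.P K) 0 → Matrix (Fin 2) (Fin 2) ℂ} :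
    nMax19 F n K U₀ X ≤ ε ↔
      (∀ b : PBond (F.P K) 0, ‖X b‖ ≤ ε * eta F n K) ∧
      (∀ (μ ν : Fin (F.P K).d) (x : Site (F.P K) 0), ‖covGradT 1 (bgUnits F K U₀) X μ ν x‖ ≤ ε * eta F n K ^ 2) ∧
      (∀ (μ : Fin (F.P K).d) (x : Site (F.P K) 0), ‖covCodiffCurlT 1 (bgUnits F K U₀) X μ x‖ ≤ ε * eta F n K ^ 3) ∧
      (∀ (ν : Fin (F.P K).d) (x : Site (F.P K) 0), ‖covLapFormT 1 (bgUnits F K U₀) X ν x‖ ≤ ε * eta F n K ^ 3) := by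
  have hη : 0 < eta F n K := eta_pos F n K
  have hη2 : 0 < eta F n K ^ 2 := pow_pos hη 2
  have hη3 : 0 < eta F n K ^ 3 := pow_pos hη 3
  simp only [nMax19, max_le_iff, Finset.sup'_le_iff, Finset.mem_univ, forall_const, div_le_iff₀ hη, div_le_iff₀ hη2, div_le_iff₀ hη3,
    Prod.forall, and_assoc]

/-- `0 ≤ nMax19 U₀ X`. [cite: Balaban1985Variational, (19) p.281] -/
theorem nMax19_nonneg (U₀ : GaugeField (F.P K) 0 (Matrix.specialUnitaryGroup (Fin 2) ℂ)) (X : PBond (F.P K) 0 → Matrix (Fin 2) (Fin 2) ℂ) :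
    0 ≤ nMax19 F n K U₀ X := by
  obtain ⟨b₀, hb₀⟩ := univ_pbond_nonempty (F.P K) 0
  exact le_max_of_le_left (le_max_of_le_left
    (Finset.le_sup'_of_le _ hb₀ (div_nonneg (norm_nonneg _) (eta_pos F n K).le)))

/-- ELIM, order 0: `‖X(b)‖ ≤ nMax19 U₀ X · η`. [cite: Balaban1985Variational, (19) p.281] -/
theorem norm_le_nMax19_mul_eta (U₀ : GaugeField (F.P K) 0 (Matrix.specialUnitaryGroup (Fin 2) ℂ)) (X : PBond (F.P K) 0 → Matrix (Fin 2) (Fin 2) ℂ)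
    (b : PBond (F.P K) 0) : ‖X b‖ ≤ nMax19 F n K U₀ X * eta F n K :=
  (nMax19_le_iff.mp le_rfl).1 b

/-- ELIM, order 1: `‖(∇¹_{U₀}X)_{μν}(x)‖ ≤ nMax19 U₀ X · η²`. [cite: Balaban1985Variational, (19) p.281] -/
theorem norm_covGradT_le_nMax19 (U₀ : GaugeField (F.P K) 0 (Matrix.specialUnitaryGroup (Fin 2) ℂ)) (X : PBond (F.P K) 0 → Matrix (Fin 2) (Fin 2) ℂ)
    (μ ν : Fin (F.P K).d) (x : Site (F.P K) 0) : ‖covGradT 1 (bgUnits F K U₀) X μ ν x‖ ≤ nMax19 F n K U₀ X * eta F n K ^ 2 :=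
  (nMax19_le_iff.mp le_rfl).2.1 μ ν x

/-- ELIM, order 2: `‖(D¹*_{U₀}D¹_{U₀}X)_μ(x)‖ ≤ nMax19 U₀ X · η³`. [cite: Balaban1985Variational, (19) p.281] -/
theorem norm_covCodiffCurlT_le_nMax19 (U₀ : GaugeField (F.P K) 0 (Matrix.specialUnitaryGroup (Fin 2) ℂ)) (X : PBond (F.P K) 0 → Matrix (Fin 2) (Fin 2) ℂ)
    (μ : Fin (F.P K).d) (x : Site (F.P K) 0) : ‖covCodiffCurlT 1 (bgUnits F K U₀) X μ x‖ ≤ nMax19 F n K U₀ X * eta F n K ^ 3 :=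
  (nMax19_le_iff.mp le_rfl).2.2.1 μ x

/-- ELIM, order 2: `‖(Δ¹_{U₀}X)_ν(x)‖ ≤ nMax19 U₀ X · η³`. [cite: Balaban1985Variational, (19) p.281] -/
theorem norm_covLapFormT_le_nMax19 (U₀ : GaugeField (F.P K) 0 (Matrix.specialUnitaryGroup (Fin 2) ℂ)) (X : PBond (F.P K) 0 → Matrix (Fin 2) (Fin 2) ℂ)
    (ν : Fin (F.P K).d) (x : Site (F.P K) 0) : ‖covLapFormT 1 (bgUnits F K U₀) X ν x‖ ≤ nMax19 F n K U₀ X * eta F n K ^ 3 :=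
  (nMax19_le_iff.mp le_rfl).2.2.2 ν x

/-- ★ **TRIANGLE INEQUALITY FOR THE (19)-SIZE**: `nMax19 U₀ (X + Y) ≤ nMax19 U₀ X + nMax19 U₀ Y` (the four families are additive, §1, and the
norm is subadditive). [cite: Balaban1985Variational, (19) p.281, p.299] -/
theorem nMax19_add_le (U₀ : GaugeField (F.P K) 0 (Matrix.specialUnitaryGroup (Fin 2) ℂ)) (X Y : PBond (F.P K) 0 → Matrix (Fin 2) (Fin 2) ℂ) :
    nMax19 F n K U₀ (X + Y) ≤ nMax19 F n K U₀ X + nMax19 F n K U₀ Y := by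
  refine nMax19_le_iff.mpr ⟨fun b => ?_, fun μ ν x => ?_, fun μ x => ?_, fun ν x => ?_⟩
  · rw [Pi.add_apply, add_mul]
    exact (norm_add_le _ _).trans (add_le_add (norm_le_nMax19_mul_eta U₀ X b) (norm_le_nMax19_mul_eta U₀ Y b))
  · rw [covGradT_add, add_mul]
    exact (norm_add_le _ _).trans (add_le_add (norm_covGradT_le_nMax19 U₀ X μ ν x) (norm_covGradT_le_nMax19 U₀ Y μ ν x))
  · rw [covCodiffCurlT_add, add_mul]
    exact (norm_add_le _ _).trans (add_le_add (norm_covCodiffCurlT_le_nMax19 U₀ X μ x) (norm_covCodiffCurlT_le_nMax19 U₀ Y μ x))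
  · rw [covLapFormT_add, add_mul]
    exact (norm_add_le _ _).trans (add_le_add (norm_covLapFormT_le_nMax19 U₀ X ν x) (norm_covLapFormT_le_nMax19 U₀ Y ν x))

/-- ★ **HOMOGENEITY (upper bound)**: `nMax19 U₀ (c•X) ≤ ‖c‖·nMax19 U₀ X` for complex `c` (e.g. `c = −i`, `c = η`). [cite: Balaban1985Variational, (19) p.281] -/
theorem nMax19_smul_le (U₀ : GaugeField (F.P K) 0 (Matrix.specialUnitaryGroup (Fin 2) ℂ)) (c : ℂ) (X : PBond (F.P K) 0 → Matrix (Fin 2) (Fin 2) ℂ) :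
    nMax19 F n K U₀ (c • X) ≤ ‖c‖ * nMax19 F n K U₀ X := by
  refine nMax19_le_iff.mpr ⟨fun b => ?_, fun μ ν x => ?_, fun μ x => ?_, fun ν x => ?_⟩
  · rw [Pi.smul_apply, norm_smul, mul_assoc]
    exact mul_le_mul_of_nonneg_left (norm_le_nMax19_mul_eta U₀ X b) (norm_nonneg c)
  · rw [covGradT_smul_complex, norm_smul, mul_assoc]
    exact mul_le_mul_of_nonneg_left (norm_covGradT_le_nMax19 U₀ X μ ν x) (norm_nonneg c)
  · rw [covCodiffCurlT_smul_complex, norm_smul, mul_assoc]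
    exact mul_le_mul_of_nonneg_left (norm_covCodiffCurlT_le_nMax19 U₀ X μ x) (norm_nonneg c)
  · rw [covLapFormT_smul_complex, norm_smul, mul_assoc]
    exact mul_le_mul_of_nonneg_left (norm_covLapFormT_le_nMax19 U₀ X ν x) (norm_nonneg c)

/-- `nMax19 U₀ 0 = 0`. [cite: Balaban1985Variational, (19) p.281] -/
theorem nMax19_zero (U₀ : GaugeField (F.P K) 0 (Matrix.specialUnitaryGroup (Fin 2) ℂ)) :
    nMax19 F n K U₀ (0 : PBond (F.P K) 0 → Matrix (Fin 2) (Fin 2) ℂ) = 0 := by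
  refine le_antisymm ?_ (nMax19_nonneg U₀ 0)
  have h := nMax19_smul_le (n := n) U₀ (0 : ℂ) (0 : PBond (F.P K) 0 → Matrix (Fin 2) (Fin 2) ℂ)
  rwa [zero_smul, norm_zero, zero_mul] at h

/-- **HOMOGENEITY (exact) for unit scalars**: `‖c‖ = 1 ⟹ nMax19 U₀ (c•X) = nMax19 U₀ X` (the knit's `X := −i·χ(A′)` has the size of `χ(A′)`).
[cite: Balaban1985Variational, (19) p.281, (112) p.294] -/
theorem nMax19_smul_of_norm_eq_one (U₀ : GaugeField (F.P K) 0 (Matrix.specialUnitaryGroup (Fin 2) ℂ)) {c : ℂ} (hc : ‖c‖ = 1)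
    (X : PBond (F.P K) 0 → Matrix (Fin 2) (Fin 2) ℂ) : nMax19 F n K U₀ (c • X) = nMax19 F n K U₀ X := by
  have hc0 : c ≠ 0 := fun h => by rw [h, norm_zero] at hc; exact zero_ne_one hc
  refine le_antisymm (by simpa only [hc, one_mul] using nMax19_smul_le (n := n) U₀ c X) ?_
  have h := nMax19_smul_le (n := n) U₀ c⁻¹ (c • X)
  rwa [smul_smul, inv_mul_cancel₀ hc0, one_smul, norm_inv, hc, inv_one, one_mul] at h

/-- `nMax19 U₀ (−X) = nMax19 U₀ X`. [cite: Balaban1985Variational, (19) p.281] -/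
theorem nMax19_neg (U₀ : GaugeField (F.P K) 0 (Matrix.specialUnitaryGroup (Fin 2) ℂ)) (X : PBond (F.P K) 0 → Matrix (Fin 2) (Fin 2) ℂ) :
    nMax19 F n K U₀ (-X) = nMax19 F n K U₀ X := by
  rw [← neg_one_smul ℂ X]
  exact nMax19_smul_of_norm_eq_one U₀ (by rw [norm_neg, norm_one]) X

/-- `nMax19 U₀ (X − Y) ≤ nMax19 U₀ X + nMax19 U₀ Y`. [cite: Balaban1985Variational, (19) p.281] -/
theorem nMax19_sub_le (U₀ : GaugeField (F.P K) 0 (Matrix.specialUnitaryGroup (Fin 2) ℂ)) (X Y : PBond (F.P K) 0 → Matrix (Fin 2) (Fin 2) ℂ) :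
    nMax19 F n K U₀ (X - Y) ≤ nMax19 F n K U₀ X + nMax19 F n K U₀ Y := by
  rw [sub_eq_add_neg, ← nMax19_neg U₀ Y]
  exact nMax19_add_le U₀ X (-Y)

/-- `nMax19 U₀ (Σ_{i∈s} X i) ≤ Σ_{i∈s} nMax19 U₀ (X i)`. [cite: Balaban1985Variational, (19) p.281] -/
theorem nMax19_sum_le {ι : Type*} (U₀ : GaugeField (F.P K) 0 (Matrix.specialUnitaryGroup (Fin 2) ℂ)) (s : Finset ι)
    (X : ι → PBond (F.P K) 0 → Matrix (Fin 2) (Fin 2) ℂ) :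
    nMax19 F n K U₀ (∑ i ∈ s, X i) ≤ ∑ i ∈ s, nMax19 F n K U₀ (X i) := by
  classical
  induction s using Finset.induction_on with
  | empty => rw [Finset.sum_empty, Finset.sum_empty, nMax19_zero]
  | insert i s hi ih =>
    rw [Finset.sum_insert hi, Finset.sum_insert hi]
    calc nMax19 F n K U₀ (X i + ∑ j ∈ s, X j)
        ≤ nMax19 F n K U₀ (X i) + nMax19 F n K U₀ (∑ j ∈ s, X j) := nMax19_add_le U₀ (X i) _
      _ ≤ nMax19 F n K U₀ (X i) + ∑ j ∈ s, nMax19 F n K U₀ (X j) := by gcongr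

/-! ## §3 The split reader for (i): `X = c•(a•(X₁ + X₂) − X₃)`, `‖c‖ = 1` -/

/-- The knit's outer unit scalar in LAMBDA form: `nMax19 U₀ (fun b ↦ c • Z b) = nMax19 U₀ Z` for `‖c‖ = 1` (v3.3ˢ `hSize19`: `c = −i`).
[cite: Balaban1985Variational, (112) p.294] -/
theorem nMax19_lambda_smul_of_norm_eq_one (U₀ : GaugeField (F.P K) 0 (Matrix.specialUnitaryGroup (Fin 2) ℂ)) {c : ℂ} (hc : ‖c‖ = 1)
    (Z : PBond (F.P K) 0 → Matrix (Fin 2) (Fin 2) ℂ) :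
    nMax19 F n K U₀ (fun b : PBond (F.P K) 0 => c • Z b) = nMax19 F n K U₀ Z :=
  nMax19_smul_of_norm_eq_one U₀ hc Z

/-- ★ **THE (i)-SPLIT**: for `Z = a•(X₁ + X₂) − X₃` (print's `(1∕iη) log U₁ = A₁ + H₁B − HD(A₁ + H₁B)`, [Balaban1985Variational] (112) p.294 ∕ p.299; v3.3ˢ
`hSize19`: `a = η·i`, `X₁ = ιA₁`, `X₂ = ι(H₁B)`, `X₃ = H(D A′)`), `nMax19 U₀ Z ≤ ‖a‖·nMax19 U₀ X₁ + ‖a‖·nMax19 U₀ X₂ + nMax19 U₀ X₃`.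
[cite: Balaban1985Variational, (112) p.294, p.299] -/
theorem nMax19_split_le (U₀ : GaugeField (F.P K) 0 (Matrix.specialUnitaryGroup (Fin 2) ℂ)) (a : ℂ)
    (X₁ X₂ X₃ : PBond (F.P K) 0 → Matrix (Fin 2) (Fin 2) ℂ) :
    nMax19 F n K U₀ (a • (X₁ + X₂) - X₃) ≤ ‖a‖ * nMax19 F n K U₀ X₁ + ‖a‖ * nMax19 F n K U₀ X₂ + nMax19 F n K U₀ X₃ := by
  calc nMax19 F n K U₀ (a • (X₁ + X₂) - X₃)
      ≤ nMax19 F n K U₀ (a • (X₁ + X₂)) + nMax19 F n K U₀ X₃ := nMax19_sub_le U₀ _ _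
    _ ≤ ‖a‖ * nMax19 F n K U₀ (X₁ + X₂) + nMax19 F n K U₀ X₃ := by gcongr; exact nMax19_smul_le U₀ a _
    _ ≤ ‖a‖ * (nMax19 F n K U₀ X₁ + nMax19 F n K U₀ X₂) + nMax19 F n K U₀ X₃ := by gcongr; exact nMax19_add_le U₀ _ _
    _ = ‖a‖ * nMax19 F n K U₀ X₁ + ‖a‖ * nMax19 F n K U₀ X₂ + nMax19 F n K U₀ X₃ := by ring

/-- ★ **THE (i)-SPLIT, BOUND FORM, IN THE KNIT'S SHAPE**: member rows `nMax19 U₀ X₁ ≤ m₁`, `nMax19 U₀ X₂ ≤ m₂`, `nMax19 U₀ X₃ ≤ m₃` and `‖c‖ = 1` give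
`nMax19 U₀ (fun b ↦ c • (a•(X₁ + X₂) − X₃) b) ≤ ‖a‖·(m₁ + m₂) + m₃` — ONE step from the per-term rows ((115)–(116)∕(136) for `A₁`; (45)–(46)∕(137)–(140) for
`H₁B` and `HD(A′₁)`) to the left-hand side of `hSize19′`. [cite: Balaban1985Variational, p.299] -/
theorem nMax19_split_le_of_le (U₀ : GaugeField (F.P K) 0 (Matrix.specialUnitaryGroup (Fin 2) ℂ)) {c : ℂ} (hc : ‖c‖ = 1) (a : ℂ)
    {X₁ X₂ X₃ : PBond (F.P K) 0 → Matrix (Fin 2) (Fin 2) ℂ} {m₁ m₂ m₃ : ℝ}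
    (h₁ : nMax19 F n K U₀ X₁ ≤ m₁) (h₂ : nMax19 F n K U₀ X₂ ≤ m₂) (h₃ : nMax19 F n K U₀ X₃ ≤ m₃) :
    nMax19 F n K U₀ (fun b : PBond (F.P K) 0 => c • (a • (X₁ + X₂) - X₃) b) ≤ ‖a‖ * (m₁ + m₂) + m₃ := by
  rw [nMax19_lambda_smul_of_norm_eq_one U₀ hc]
  calc nMax19 F n K U₀ (a • (X₁ + X₂) - X₃)
      ≤ ‖a‖ * nMax19 F n K U₀ X₁ + ‖a‖ * nMax19 F n K U₀ X₂ + nMax19 F n K U₀ X₃ := nMax19_split_le U₀ a X₁ X₂ X₃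
    _ ≤ ‖a‖ * m₁ + ‖a‖ * m₂ + m₃ := by gcongr
    _ = ‖a‖ * (m₁ + m₂) + m₃ := by ring

end Size

end Summit.QuantumFields.YangMills.Theorems.Prop7NMax19Algebra

end
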